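import Summits.BirchSwinnertonDyer.BirchSwinnertonDyer.Theorems.KolyvaginRoadThreeMethod2LevelSystems
import HarnessLib

/-!
# Route `KolyvaginRoadThree`, crux `ZhangSharpFrameAtThreeHL` (item stmt-BirchSwinnertonDyer-19574), stub S2-KS:
# a `LevelKolyvaginSystem` needs classes and axioms ONLY AT EVEN GOOD LEVELS — the odd (definite) levels are filled by `0`
# (cell `bsd-stepL`, OWNER seat `bsd-stepL-koly` g16; `--supports stmt-BirchSwinnertonDyer-19574 --as helper`)

Stub S2-KS of the registered METHOD line v3 asks `Nonempty (Method2.LevelKolyvaginSystem W K Dt β ι c)` (tree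
`Theorems/KolyvaginRoadThreeMethod2LevelSystems.lean`, zhang3-p1 g8). Its axiom fields (`sign`, `selmer_off`, `selmer_inf`, `ordinary_on`,
`transverse_on`, `relation`, `transport`, `baseCase`) are quantified over ALL good non-empty levels `n` (finite sets of unipotent-admissible
primes). In W. Zhang's genuine model (CJM 2014, §3.1, §3.9 (3.30)) classes `c(∏m, ∏n)` exist only when `#n` is EVEN (indefinite quaternion
algebra, Shimura CURVE `X_{N,∏n}` with CM points); at ODD levels the algebra is definite (a Shimura SET, special values, no cohomology
classes). The owner truth audit (koly g16, `HOME/koly/S2KS-TRUTH-AUDIT-g16.md`) observed that the structure is nevertheless faithful because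
every odd-level field is satisfied by the ZERO classes, `transport` lands two levels down (same parity) and `baseCase` is asked at even
levels only. THIS FILE is the kernel form of that observation:

* `nonempty_levelKolyvaginSystem_of_evenLevels` — from classes `κ₀ m n` and signs `ε₀ n` with the `realisation` identity at `∅` and the
  eight axioms asked ONLY at EVEN good non-empty levels (each field's text VERBATIM plus the guard `Even n.card →`; `transport` guarded by
  `Even n.card` of its bottom level), a `LevelKolyvaginSystem` EXISTS: `κ m n := if Even n.card then κ₀ m n else 0`.
So whoever constructs W. Zhang's level Kolyvagin systems at `p = 3` (the definition-lane programme: Shimura curves `X_{N,∏n}`, CM points, JL,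
Thm 4.3, Thm 7.2) owes data and proofs at the indefinite levels only — exactly as in print. 0 defs, 0 named facts, 0 `sorry`; closes nothing
(T7). PARTITION: O2@3 (B10) × A1 × crux 19574 × stub S2-KS — proves-glue (shape reduction of the residual stub).

References: [cite: WZhang2014, §3.1 (X_{N⁺,N⁻m} for m ∈ Λ'⁺ vs the Shimura set for m ∈ Λ'⁻), §3.9 (3.30), §8.1, Thm. 4.3, Thm. 7.2, §9].
-/

noncomputable section

open scoped Classical

namespace Summit.BirchSwinnertonDyer.Rank1Residual.X11b.Three.Koly.Method2EvenLevels

open WeierstrassCurve NumberField IsDedekindDomain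
  Literature.NumberTheory.EllipticCurves Literature.NumberTheory.EllipticCurves.ModularForms
  Literature.NumberTheory.GaloisRepresentations Module

open Summit.BirchSwinnertonDyer.Rank1Residual.X11b.Three.Koly.Method2

variable (W : WeierstrassCurve ℚ) (K : Type) [Field K] [NumberField K]
  [W.IsGloballyMinimal] [NeZero (W.conductorNorm ℤ)]
  (Dt : ModularParametrizationData W (W.conductorNorm ℤ)) (β : ℤ) (ι : K →+* ℂ) (c : K ≃ₐ[ℚ] K)
  [Module (ZMod 3) (V3 W K)]

omit [NeZero (W.conductorNorm ℤ)] [Module (ZMod 3) (V3 W K)] in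
/-- The base locus at a level depends only on the classes AT that level. [cite: WZhang2014, Def. 8.3] -/
theorem baseLocusQ_congr {M : Type} {κ κ' : M → Finset {q // IsUAdmissiblePrime W K q} → V3 W K}
    {n : Finset {q // IsUAdmissiblePrime W K q}} (h : ∀ m, κ m n = κ' m n) :
    baseLocusQ W K κ n = baseLocusQ W K κ' n := by
  ext q
  simp only [baseLocusQ, Set.mem_setOf_eq, h]

/-- Inserting two NEW primes preserves the parity of a level. [folklore] -/
theorem even_card_insert_insert_iff {α : Type*} [DecidableEq α] {n : Finset α} {q₁ q₂ : α} (h₁ : q₁ ∉ n)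
    (h₂ : q₂ ∉ insert q₁ n) : Even (insert q₂ (insert q₁ n)).card ↔ Even n.card := by
  rw [Finset.card_insert_of_notMem h₂, Finset.card_insert_of_notMem h₁, add_assoc]
  exact (Nat.even_add (n := 2)).trans (by simp)

/-- **A `LevelKolyvaginSystem` from EVEN-level data.** Given classes `κ₀ m n ∈ H¹(K, E[3])` and signs `ε₀ n`, the `realisation` identity at
level `∅`, and the axioms `sign` ∕ `selmer_off` ∕ `selmer_inf` ∕ `ordinary_on` ∕ `transverse_on` ∕ `relation` ∕ `baseCase` at EVEN good
non-empty levels and `transport` from even bottom levels (each the structure's field text with the extra guard `Even n.card →`), the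
classes `κ m n := if Even n.card then κ₀ m n else 0` form a `Method2.LevelKolyvaginSystem W K Dt β ι c`: at odd levels every axiom holds
for the zero class (`0` lies in every local-condition subgroup; `conjAct 0 = s • 0`; `transport`'s hypothesis `q₂ ∉ baseLocus` fails when all
classes two levels up vanish), and two-step transport ∕ the base case live at even levels. This is W. Zhang's own bookkeeping (classes on the
Shimura CURVES `X_{N,∏n}`, `#n` even; the odd levels carry the definite Shimura sets and no classes). [cite: WZhang2014, §3.1, §3.9 (3.30), §9] -/
theorem nonempty_levelKolyvaginSystem_of_evenLevels
    (ε₀ : Finset {q // IsUAdmissiblePrime W K q} → Bool)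
    (κ₀ : Finset {ℓ // Zhang2014.IsKolyvaginPrime (W.conductorNorm ℤ) W K 3 ℓ} →
      Finset {q // IsUAdmissiblePrime W K q} → V3 W K)
    (realisation : ∀ m : Finset {ℓ // Zhang2014.IsKolyvaginPrime (W.conductorNorm ℤ) W K 3 ℓ},
      ∃ d : KolyvaginHeegnerData Dt β ι (∏ ℓ ∈ m, (ℓ : ℕ)), κ₀ m ∅ = d.kolyvaginClass Nat.prime_three 1)
    (sign : ∀ n, GoodLevel W K n → n.Nonempty → Even n.card →
      ∀ m : Finset {ℓ // Zhang2014.IsKolyvaginPrime (W.conductorNorm ℤ) W K 3 ℓ},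
      conjAct W c ((3 ^ 1 : ℕ) : ℤ) (κ₀ m n) = sgn (ε₀ n ^^ Nat.bodd m.card) • κ₀ m n)
    (selmer_off : ∀ n, GoodLevel W K n → n.Nonempty → Even n.card →
      ∀ (m : Finset {ℓ // Zhang2014.IsKolyvaginPrime (W.conductorNorm ℤ) W K 3 ℓ}) (v : HeightOneSpectrum (𝓞 K)),
      (∀ ℓ ∈ m, ((ℓ : ℕ) : 𝓞 K) ∉ v.asIdeal) → (∀ q ∈ n, ((q : ℕ) : 𝓞 K) ∉ v.asIdeal) →
      κ₀ m n ∈ selmerLocalKer (W.baseChange K) (v.adicCompletion K) ((3 ^ 1 : ℕ) : ℤ))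
    (selmer_inf : ∀ n, GoodLevel W K n → n.Nonempty → Even n.card →
      ∀ (m : Finset {ℓ // Zhang2014.IsKolyvaginPrime (W.conductorNorm ℤ) W K 3 ℓ}) (w : InfinitePlace K),
      κ₀ m n ∈ selmerLocalKer (W.baseChange K) w.Completion ((3 ^ 1 : ℕ) : ℤ))
    (ordinary_on : ∀ n, GoodLevel W K n → n.Nonempty → Even n.card →
      ∀ m : Finset {ℓ // Zhang2014.IsKolyvaginPrime (W.conductorNorm ℤ) W K 3 ℓ}, ∀ q ∈ n, ∀ v : HeightOneSpectrum (𝓞 K),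
      ((q : ℕ) : 𝓞 K) ∈ v.asIdeal → κ₀ m n ∈ (W.baseChange K).ordinaryLocalKer (v.adicCompletion K) ((3 ^ 1 : ℕ) : ℤ))
    (transverse_on : ∀ n, GoodLevel W K n → n.Nonempty → Even n.card →
      ∀ m : Finset {ℓ // Zhang2014.IsKolyvaginPrime (W.conductorNorm ℤ) W K 3 ℓ}, ∀ ℓ ∈ m, ∀ v : HeightOneSpectrum (𝓞 K),
      ((ℓ : ℕ) : 𝓞 K) ∈ v.asIdeal → κ₀ m n ∈ transverseLocalKer W K ι ℓ v)
    (relation : ∀ n, GoodLevel W K n → n.Nonempty → Even n.card →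
      ∀ (m : Finset {ℓ // Zhang2014.IsKolyvaginPrime (W.conductorNorm ℤ) W K 3 ℓ})
        (ℓ : {ℓ // Zhang2014.IsKolyvaginPrime (W.conductorNorm ℤ) W K 3 ℓ}), ℓ ∉ m → ∀ v : HeightOneSpectrum (𝓞 K),
      ((ℓ : ℕ) : 𝓞 K) ∈ v.asIdeal →
      (κ₀ (insert ℓ m) n ∈ (W.baseChange K).torsionLocalKer (v.adicCompletion K) ((3 ^ 1 : ℕ) : ℤ) ↔
        κ₀ m n ∈ (W.baseChange K).torsionLocalKer (v.adicCompletion K) ((3 ^ 1 : ℕ) : ℤ)))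
    (transport : ∀ (n : Finset {q // IsUAdmissiblePrime W K q}) (q₁ q₂ : {q // IsUAdmissiblePrime W K q}),
      GoodLevel W K n → GoodLevel W K (insert q₁ n) → GoodLevel W K (insert q₂ (insert q₁ n)) →
      q₁ ∉ n → q₂ ∉ insert q₁ n → Even n.card → q₂ ∉ baseLocusQ W K κ₀ (insert q₂ (insert q₁ n)) → ∃ m, κ₀ m n ≠ 0)
    (baseCase : ∀ n, GoodLevel W K n → n.Nonempty → Even n.card →
      finrank (ZMod 3) (SelQ W K c n true) + finrank (ZMod 3) (SelQ W K c n false) = 1 → κ₀ ∅ n ≠ 0) :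
    Nonempty (LevelKolyvaginSystem W K Dt β ι c) := by
  -- the classes: `κ₀` at even levels, `0` at odd (definite) levels
  let κ : Finset {ℓ // Zhang2014.IsKolyvaginPrime (W.conductorNorm ℤ) W K 3 ℓ} →
      Finset {q // IsUAdmissiblePrime W K q} → V3 W K := fun m n ↦ if Even n.card then κ₀ m n else 0
  have hκ_even : ∀ {n} (hn : Even n.card) (m), κ m n = κ₀ m n := fun hn m ↦ if_pos hn
  have hκ_odd : ∀ {n} (hn : ¬ Even n.card) (m), κ m n = 0 := fun hn m ↦ if_neg hn
  refine ⟨⟨ε₀, κ, ?_, ?_, ?_, ?_, ?_, ?_, ?_, ?_, ?_⟩⟩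
  · -- realisation at `∅` (even)
    intro m
    rw [hκ_even (by simp) m]
    exact realisation m
  · -- sign
    intro n hn hne m
    by_cases he : Even n.card
    · rw [hκ_even he]; exact sign n hn hne he m
    · rw [hκ_odd he, map_zero, zsmul_zero]
  · -- selmer_off
    intro n hn hne m v hm hq
    by_cases he : Even n.card
    · rw [hκ_even he]; exact selmer_off n hn hne he m v hm hq
    · rw [hκ_odd he]; exact zero_mem _
  · -- selmer_inf
    intro n hn hne m w
    by_cases he : Even n.card
    · rw [hκ_even he]; exact selmer_inf n hn hne he m w
    · rw [hκ_odd he]; exact zero_mem _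
  · -- ordinary_on
    intro n hn hne m q hq v hv
    by_cases he : Even n.card
    · rw [hκ_even he]; exact ordinary_on n hn hne he m q hq v hv
    · rw [hκ_odd he]; exact zero_mem _
  · -- transverse_on
    intro n hn hne m ℓ hℓ v hv
    by_cases he : Even n.card
    · rw [hκ_even he]; exact transverse_on n hn hne he m ℓ hℓ v hv
    · rw [hκ_odd he]; exact zero_mem _
  · -- relation (8.1)
    intro n hn hne m ℓ hℓ v hv
    by_cases he : Even n.card
    · rw [hκ_even he, hκ_even he]; exact relation n hn hne he m ℓ hℓ v hv
    · rw [hκ_odd he, hκ_odd he]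
  · -- transport (A2): two NEW primes keep the parity
    intro n q₁ q₂ hn hn₁ hn₂ hq₁ hq₂ hbase
    have hpar := even_card_insert_insert_iff (n := n) hq₁ hq₂
    by_cases he : Even n.card
    · have he₂ : Even (insert q₂ (insert q₁ n)).card := hpar.mpr he
      rw [baseLocusQ_congr W K (fun m ↦ hκ_even he₂ m)] at hbase
      obtain ⟨m, hm⟩ := transport n q₁ q₂ hn hn₁ hn₂ hq₁ hq₂ he hbase
      exact ⟨m, by rwa [hκ_even he]⟩
    · -- odd bottom level: the top level is odd too, all classes there vanish, so `q₂` IS a base point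
      have ho₂ : ¬ Even (insert q₂ (insert q₁ n)).card := fun h ↦ he (hpar.mp h)
      exact absurd (fun m v _ ↦ by rw [hκ_odd ho₂ m]; exact zero_mem _) hbase
  · -- base case (A5) at even levels
    intro n hn hne he h1
    rw [hκ_even he]
    exact baseCase n hn hne he h1

end Summit.BirchSwinnertonDyer.Rank1Residual.X11b.Three.Koly.Method2EvenLevels

end
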